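import Summits.PneNP.PneNP.Theorems.ExpanderLinearGeneratorsColumnTwoRobust

/-!
# PneNP / ExpanderLinearGenerators — large clique minors in GLOBAL expanders of any rate:
the robust core

Route `PneNP/ExpanderLinearGenerators` (column-weight-two routing machinery), support for crux
stmt-PneNP-11427 (`EvenHypergraphTseitinDepthFregeLB`, route `PneNP/MatroidTseitin`, the case
`k = 1` = Tseitin on bounded-degree expander GRAPHS). The clique-minor engine of
`…ColumnTwoMinor` (Krivelevich–Sudakov for LOSSLESS local expansion, small sets growing by the
factor `1.488`) does not apply to expanders of rate `α < 1`. This file supplies the engine for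
GLOBAL expansion of an arbitrary rate `a/b` (every `W ⊆ U` with `2|W| ≤ |U|` has
`a|W| ≤ b|nbr U W|`), in the scopes vocabulary of `…ColumnTwoDefs`:

* SLACK sets (`4|Y| ≤ N`, `2b |nbr U Y \ R| ≤ a|Y|`) are small (`card_le_of_slack`); a maximal
  slack set `X` leaves a ROBUST CORE `(U \ R) \ X` all of whose small sets expand at rate `a/(2b)`
  (`core_expansion`), so that balls in the core pass `N/8` rows in `t₁` steps and `N/2` rows in
  `6b` more (`ball_core_eighth`, `ball_core_half`), and any two core rows are joined by a
  connected set of `≤ 2(t₁ + 6b) + 2` core rows (`exists_conn_pair`);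
* padding a connected set to a prescribed size inside a ball (`exists_conn_superset_card_eq`)
  and stars of connected sets (`isConn_insert_biUnion`).

The iteration itself (Krivelevich–Sudakov with monotone death) is `…ColumnTwoExpanderMinor`.

References: M. Krivelevich, B. Sudakov, *Minors in expanding graphs*, GAFA 19 (2009) 294–331,
Theorem 1.1/§4 (the iteration); M. Krivelevich, *Expanders — how to find them, and what to find
in them*, Surveys in Combinatorics 2019, §8.
-/

namespace Summit.PneNP.PneNP.Theorems.ColumnTwo

set_option linter.dupNamespace false -- `Summit.PneNP.PneNP.…`: summit = sub-problem (D-0017)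

open Finset Literature.Computability.MetaComplexity

variable {ι : Type*} [DecidableEq ι] {S : ι → Finset ℕ}

/-! ### Slack sets -/

/-- **Slack sets are small.** If every `W ⊆ U` with `2|W| ≤ N = |U|` has `a|W| ≤ b|nbr U W|`,
then a set `Y ⊆ U` with `4|Y| ≤ N` and `2b |nbr U Y \ R| ≤ a |Y|` has `a|Y| ≤ 2b|R|`.
[cite: KrivelevichSudakov2009Minors, §4] -/
theorem card_le_of_slack {U R Y : Finset ι} {N a b : ℕ} (hN : U.card = N)
    (hexp : ∀ W ⊆ U, 2 * W.card ≤ N → a * W.card ≤ b * (nbr S U W).card)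
    (hY : Y ⊆ U) (h4 : 4 * Y.card ≤ N) (hslack : 2 * b * (nbr S U Y \ R).card ≤ a * Y.card) :
    a * Y.card ≤ 2 * b * R.card := by
  have h1 := hexp Y hY (by omega)
  have h2 : (nbr S U Y).card ≤ (nbr S U Y \ R).card + R.card := Finset.card_le_card_sdiff_add_card
  have h3 : b * (nbr S U Y).card ≤ b * (nbr S U Y \ R).card + b * R.card := by
    calc b * (nbr S U Y).card ≤ b * ((nbr S U Y \ R).card + R.card) := Nat.mul_le_mul_left _ h2
      _ = _ := by ring
  have _ := hN
  nlinarith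

/-- **A maximal slack set containing a given one.** [folklore] -/
theorem exists_maximal_slack {U R X₀ : Finset ι} {N a b : ℕ} (hX₀ : X₀ ⊆ U \ R)
    (h4 : 4 * X₀.card ≤ N) (hs : 2 * b * (nbr S U X₀ \ R).card ≤ a * X₀.card) :
    ∃ X, X₀ ⊆ X ∧ X ⊆ U \ R ∧ 4 * X.card ≤ N ∧ 2 * b * (nbr S U X \ R).card ≤ a * X.card ∧
      ∀ Y, X ⊆ Y → Y ⊆ U \ R → 4 * Y.card ≤ N → 2 * b * (nbr S U Y \ R).card ≤ a * Y.card →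
        Y = X := by
  classical
  set F := (U \ R).powerset.filter fun X => X₀ ⊆ X ∧ 4 * X.card ≤ N ∧
    2 * b * (nbr S U X \ R).card ≤ a * X.card with hF
  have hmem : ∀ {X}, X ∈ F ↔ X ⊆ U \ R ∧ X₀ ⊆ X ∧ 4 * X.card ≤ N ∧
      2 * b * (nbr S U X \ R).card ≤ a * X.card := fun {X} => by
    rw [hF, Finset.mem_filter, Finset.mem_powerset]
  have hne : F.Nonempty := ⟨X₀, hmem.2 ⟨hX₀, Finset.Subset.refl _, h4, hs⟩⟩
  obtain ⟨X, hXF, hXmax⟩ := Finset.exists_max_image F Finset.card hne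
  obtain ⟨hXU, hX₀X, hX4, hXs⟩ := hmem.1 hXF
  refine ⟨X, hX₀X, hXU, hX4, hXs, fun Y hXY hYU hY4 hYs => ?_⟩
  have hYF : Y ∈ F := hmem.2 ⟨hYU, hX₀X.trans hXY, hY4, hYs⟩
  exact (Finset.eq_of_subset_of_card_le hXY (hXmax Y hYF)).symm

/-! ### The robust core -/

/-- **Expansion of the core.** Let `X ⊆ U \ R` be a maximal slack set (`4|X| ≤ N`,
`2b|nbr U X \ R| ≤ a|X|`, no slack proper superset inside `U \ R`) and `16 b |R| ≤ a N`, `a ≥ 1`.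
Then in the core `C = (U \ R) \ X` every `Y ⊆ C` with `8|Y| ≤ N` has `a|Y| ≤ 2b |nbr C Y|`.
[cite: KrivelevichSudakov2009Minors, §4] -/
theorem core_expansion {U R X : Finset ι} {N a b : ℕ} (hN : U.card = N) (ha : 1 ≤ a)
    (hexp : ∀ W ⊆ U, 2 * W.card ≤ N → a * W.card ≤ b * (nbr S U W).card)
    (hRU : R ⊆ U) (hX : X ⊆ U \ R) (hX4 : 4 * X.card ≤ N)
    (hXs : 2 * b * (nbr S U X \ R).card ≤ a * X.card)
    (hmax : ∀ Y, X ⊆ Y → Y ⊆ U \ R → 4 * Y.card ≤ N →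
      2 * b * (nbr S U Y \ R).card ≤ a * Y.card → Y = X)
    (hbud : 16 * b * R.card ≤ a * N) :
    ∀ Y ⊆ (U \ R) \ X, 8 * Y.card ≤ N → a * Y.card ≤ 2 * b * (nbr S ((U \ R) \ X) Y).card := by
  intro Y hY hY8
  have _ := hRU
  by_contra hlt
  push Not at hlt
  -- `X` is small, so `X ∪ Y` is a candidate
  have hXsmall : a * X.card ≤ 2 * b * R.card :=
    card_le_of_slack hN hexp (hX.trans Finset.sdiff_subset) hX4 hXs
  have hX8 : 8 * X.card ≤ N := by
    have h1 : a * (8 * X.card) ≤ a * N := by nlinarith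
    exact Nat.le_of_mul_le_mul_left h1 ha
  have hdisj : Disjoint X Y := Finset.disjoint_left.2 fun j hjX hjY =>
    (Finset.mem_sdiff.1 (hY hjY)).2 hjX
  have hcard : (X ∪ Y).card = X.card + Y.card := Finset.card_union_of_disjoint hdisj
  have hsub : X ∪ Y ⊆ U \ R := Finset.union_subset hX (hY.trans Finset.sdiff_subset)
  -- neighbours of the union
  have hnbr : nbr S U (X ∪ Y) \ R ⊆ (nbr S U X \ R) ∪ nbr S ((U \ R) \ X) Y := by
    intro j hj
    rw [Finset.mem_sdiff] at hj
    obtain ⟨hj, hjR⟩ := hj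
    rcases Finset.mem_union.1 (nbr_union_subset hj) with h | h
    · exact Finset.mem_union_left _ (Finset.mem_sdiff.2 ⟨h, hjR⟩)
    · refine Finset.mem_union_right _ ?_
      obtain ⟨hjUX, hjY, i, hi, hij⟩ := mem_nbr.1 h
      rw [Finset.mem_sdiff] at hjUX
      exact mem_nbr.2 ⟨Finset.mem_sdiff.2 ⟨Finset.mem_sdiff.2 ⟨hjUX.1, hjR⟩, hjUX.2⟩, hjY, i, hi, hij⟩
  have hcn : (nbr S U (X ∪ Y) \ R).card ≤ (nbr S U X \ R).card + (nbr S ((U \ R) \ X) Y).card :=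
    (Finset.card_le_card hnbr).trans (Finset.card_union_le _ _)
  have hslack : 2 * b * (nbr S U (X ∪ Y) \ R).card ≤ a * (X ∪ Y).card := by
    rw [hcard]
    have : 2 * b * (nbr S U (X ∪ Y) \ R).card ≤
        2 * b * (nbr S U X \ R).card + 2 * b * (nbr S ((U \ R) \ X) Y).card := by
      calc 2 * b * (nbr S U (X ∪ Y) \ R).card
          ≤ 2 * b * ((nbr S U X \ R).card + (nbr S ((U \ R) \ X) Y).card) := Nat.mul_le_mul_left _ hcn
        _ = _ := by ring
    nlinarith
  have hXY := hmax (X ∪ Y) Finset.subset_union_left hsub (by rw [hcard]; omega) hslack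
  -- hence `Y = ∅`, contradicting the strict inequality
  have hYe : Y = ∅ := by
    rw [Finset.eq_empty_iff_forall_notMem]
    intro j hj
    have hjX : j ∈ X := by rw [← hXY]; exact Finset.mem_union_right _ hj
    exact (Finset.mem_sdiff.1 (hY hj)).2 hjX
  subst hYe
  simp at hlt

/-- **Balls in the core pass an eighth.** If every `Y ⊆ C` with `8|Y| ≤ N` has
`a|Y| ≤ 2b|nbr C Y|`, `|C| ≤ N` and `(2b)^{t₁} N < (2b+a)^{t₁}`, then the ball of radius `t₁`
around any nonempty `W ⊆ C` inside `C` has more than `N/8` rows. [folklore] -/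
theorem ball_core_eighth {C W : Finset ι} {N a b t₁ : ℕ}
    (hcore : ∀ Y ⊆ C, 8 * Y.card ≤ N → a * Y.card ≤ 2 * b * (nbr S C Y).card)
    (hCN : C.card ≤ N) (ht₁ : (2 * b) ^ t₁ * N < (2 * b + a) ^ t₁)
    (hW : W ⊆ C) (hne : W.Nonempty) : N < 8 * (ball S C W t₁).card := by
  have hgrow : ∀ Y, W ⊆ Y → Y ⊆ C → Y.card ≤ N / 8 → a * Y.card ≤ 2 * b * (nbr S C Y).card :=
    fun Y _ hYC hYM => hcore Y hYC (by omega)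
  rcases le_card_ball_of_growth hgrow hW t₁ with h | h
  · omega
  · exfalso
    have h1 : 1 ≤ W.card := Finset.card_pos.2 hne
    have h2 : (ball S C W t₁).card ≤ N := (Finset.card_le_card (ball_subset hW t₁)).trans hCN
    have h3 : (2 * b + a) ^ t₁ ≤ (2 * b + a) ^ t₁ * W.card := Nat.le_mul_of_pos_right _ h1
    have h4 : (2 * b) ^ t₁ * (ball S C W t₁).card ≤ (2 * b) ^ t₁ * N := Nat.mul_le_mul_left _ h2
    omega

/-- **Balls in the core pass a half.** Under the hypotheses of `ball_core_eighth`, if moreover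
the ambient `U ⊇ C` (`|U| = N`) expands at rate `a/b` up to half its size, `16 b |U \ C| ≤ a N`
and `a, b ≥ 1`, then the ball of radius `t₁ + 6b` around any nonempty `W ⊆ C` inside `C` has more
than `N/2` rows. [folklore] -/
theorem ball_core_half {U C W : Finset ι} {N a b t₁ : ℕ} (hN : U.card = N) (ha : 1 ≤ a) (hb : 1 ≤ b)
    (hexp : ∀ W ⊆ U, 2 * W.card ≤ N → a * W.card ≤ b * (nbr S U W).card)
    (hCU : C ⊆ U) (hloss : 16 * b * (U \ C).card ≤ a * N)
    (hcore : ∀ Y ⊆ C, 8 * Y.card ≤ N → a * Y.card ≤ 2 * b * (nbr S C Y).card)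
    (ht₁ : (2 * b) ^ t₁ * N < (2 * b + a) ^ t₁)
    (hW : W ⊆ C) (hne : W.Nonempty) : N < 2 * (ball S C W (t₁ + 6 * b)).card := by
  have hCN : C.card ≤ N := hN ▸ Finset.card_le_card hCU
  have h8 := ball_core_eighth hcore hCN ht₁ hW hne
  -- one step of growth of a large ball
  have hstep : ∀ Y ⊆ C, N < 8 * Y.card → 2 * Y.card ≤ N → a * N ≤ 16 * b * (nbr S C Y).card := by
    intro Y hYC hY8 hY2
    have h1 := hexp Y (hYC.trans hCU) hY2
    have h2 : (nbr S U Y).card ≤ (nbr S C Y).card + (U \ C).card := by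
      have := card_nbr_le_add (S := S) (U := U) (R := U \ C) (W := Y) Finset.sdiff_subset
      rwa [Finset.sdiff_sdiff_eq_self hCU] at this
    have h3 : b * (nbr S U Y).card ≤ b * (nbr S C Y).card + b * (U \ C).card := by
      calc b * (nbr S U Y).card ≤ b * ((nbr S C Y).card + (U \ C).card) := Nat.mul_le_mul_left _ h2
        _ = _ := by ring
    nlinarith
  -- iterate `6b` times
  have hiter : ∀ s, N < 2 * (ball S C W (t₁ + s)).card ∨
      16 * b * (ball S C W t₁).card + s * (a * N) ≤ 16 * b * (ball S C W (t₁ + s)).card := by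
    intro s
    induction s with
    | zero => exact Or.inr (by simp)
    | succ s ih =>
      rcases ih with h | h
      · exact Or.inl (lt_of_lt_of_le h (Nat.mul_le_mul_left _
          (Finset.card_le_card (ball_subset_succ C W (t₁ + s)))))
      · by_cases h2 : N < 2 * (ball S C W (t₁ + s)).card
        · exact Or.inl (lt_of_lt_of_le h2 (Nat.mul_le_mul_left _
            (Finset.card_le_card (ball_subset_succ C W (t₁ + s)))))
        · refine Or.inr ?_
          push Not at h2
          have hbig : N < 8 * (ball S C W (t₁ + s)).card :=
            lt_of_lt_of_le h8 (Nat.mul_le_mul_left _ (Finset.card_le_card (ball_mono (by omega))))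
          have hs := hstep _ (ball_subset hW _) hbig h2
          rw [show t₁ + (s + 1) = t₁ + s + 1 by ring, card_ball_succ]
          nlinarith
  rcases hiter (6 * b) with h | h
  · exact h
  · -- the accumulated growth exceeds `N/2`
    by_contra hle
    push Not at hle
    have e1 : b * N < b * (8 * (ball S C W t₁).card) := Nat.mul_lt_mul_of_pos_left h8 (by omega)
    have e2 : 6 * b * N ≤ 6 * b * (a * N) := Nat.mul_le_mul_left _ (Nat.le_mul_of_pos_left N ha)
    have e3 : 8 * b * (2 * (ball S C W (t₁ + 6 * b)).card) ≤ 8 * b * N := Nat.mul_le_mul_left _ hle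
    linarith

/-- **Joining two core rows.** Under the hypotheses of `ball_core_half`, any two rows `v, w` of
the core are joined inside the core by a connected set of at most `2(t₁ + 6b) + 2` rows
containing both. [folklore] -/
theorem exists_conn_pair {U C : Finset ι} {N a b t₁ : ℕ} (hN : U.card = N) (ha : 1 ≤ a) (hb : 1 ≤ b)
    (hexp : ∀ W ⊆ U, 2 * W.card ≤ N → a * W.card ≤ b * (nbr S U W).card)
    (hCU : C ⊆ U) (hloss : 16 * b * (U \ C).card ≤ a * N)
    (hcore : ∀ Y ⊆ C, 8 * Y.card ≤ N → a * Y.card ≤ 2 * b * (nbr S C Y).card)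
    (ht₁ : (2 * b) ^ t₁ * N < (2 * b + a) ^ t₁) {v w : ι} (hv : v ∈ C) (hw : w ∈ C) :
    ∃ P ⊆ C, IsConn S P ∧ v ∈ P ∧ w ∈ P ∧ P.card ≤ 2 * (t₁ + 6 * b) + 2 := by
  have hCN : C.card ≤ N := hN ▸ Finset.card_le_card hCU
  have hbv := ball_core_half hN ha hb hexp hCU hloss hcore ht₁ (Finset.singleton_subset_iff.2 hv)
    (Finset.singleton_nonempty v)
  have hbw := ball_core_half hN ha hb hexp hCU hloss hcore ht₁ (Finset.singleton_subset_iff.2 hw)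
    (Finset.singleton_nonempty w)
  set Bv := ball S C {v} (t₁ + 6 * b) with hBv
  set Bw := ball S C {w} (t₁ + 6 * b) with hBw
  have hBvC : Bv ⊆ C := ball_subset (Finset.singleton_subset_iff.2 hv) _
  have hBwC : Bw ⊆ C := ball_subset (Finset.singleton_subset_iff.2 hw) _
  have hint : (Bv ∩ Bw).Nonempty := by
    rw [← Finset.card_pos]
    have h1 : (Bv ∪ Bw).card ≤ N := (Finset.card_le_card (Finset.union_subset hBvC hBwC)).trans hCN
    have h2 := Finset.card_union_add_card_inter Bv Bw
    omega
  obtain ⟨u, hu⟩ := hint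
  rw [Finset.mem_inter] at hu
  obtain ⟨Q₁, hQ₁, hc₁, huQ₁, hQ₁v, hcard₁⟩ := exists_geodesic hu.1
  obtain ⟨Q₂, hQ₂, hc₂, huQ₂, hQ₂w, hcard₂⟩ := exists_geodesic hu.2
  have hvQ₁ : v ∈ Q₁ := by
    obtain ⟨x, hx⟩ := hQ₁v
    rw [Finset.mem_inter, Finset.mem_singleton] at hx
    exact hx.2 ▸ hx.1
  have hwQ₂ : w ∈ Q₂ := by
    obtain ⟨x, hx⟩ := hQ₂w
    rw [Finset.mem_inter, Finset.mem_singleton] at hx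
    exact hx.2 ▸ hx.1
  refine ⟨Q₁ ∪ Q₂, Finset.union_subset (hQ₁.trans hBvC) (hQ₂.trans hBwC),
    hc₁.union hc₂ (Or.inr ⟨u, Finset.mem_inter.2 ⟨huQ₁, huQ₂⟩⟩), Finset.mem_union_left _ hvQ₁,
    Finset.mem_union_right _ hwQ₂, (Finset.card_union_le _ _).trans (by omega)⟩

/-- **Padding a connected set**: if `W ⊆ V` is connected, `|W| ≤ q` and the ball of radius `t`
around `W` inside `V` has `≥ q` rows, then some connected `B` with `W ⊆ B ⊆ ball V W t` has
exactly `q` rows. [folklore] -/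
theorem exists_conn_superset_card_eq {V W : Finset ι} {q t : ℕ} (hW : IsConn S W)
    (hq : W.card ≤ q) (ht : q ≤ (ball S V W t).card) :
    ∃ B, W ⊆ B ∧ B ⊆ ball S V W t ∧ IsConn S B ∧ B.card = q := by
  classical
  have hex : ∃ t', q ≤ (ball S V W t').card := ⟨t, ht⟩
  have hspec := Nat.find_spec hex
  have hle : Nat.find hex ≤ t := Nat.find_min' hex ht
  rcases h0 : Nat.find hex with _ | t₁
  · rw [h0, ball_zero] at hspec
    refine ⟨W, Finset.Subset.refl _, subset_ball V W t, hW, le_antisymm hq hspec⟩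
  · rw [h0] at hspec hle
    have hlt : (ball S V W t₁).card < q := by
      have := Nat.find_min hex (show t₁ < Nat.find hex by omega)
      omega
    rw [card_ball_succ] at hspec
    obtain ⟨N', hN', hcard⟩ := Finset.exists_subset_card_eq
      (show q - (ball S V W t₁).card ≤ (nbr S V (ball S V W t₁)).card by omega)
    refine ⟨ball S V W t₁ ∪ N', (subset_ball V W t₁).trans Finset.subset_union_left, ?_, ?_, ?_⟩
    · refine le_trans ?_ (ball_mono hle)
      rw [ball_succ]
      exact Finset.union_subset_union (Finset.Subset.refl _) hN'
    · exact (isConn_ball hW t₁).union_nbrs fun n hn => (mem_nbr.1 (hN' hn)).2.2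
    · rw [Finset.card_union_of_disjoint, hcard]
      · omega
      · exact Finset.disjoint_left.2 fun j hj hj' => (mem_nbr.1 (hN' hj')).2.1 hj

/-- A star of connected sets through a common row is connected. [folklore] -/
theorem isConn_insert_biUnion {v : ι} (I : Finset ℕ) (P : ℕ → Finset ι)
    (hP : ∀ i ∈ I, (P i).Nonempty → IsConn S (P i) ∧ v ∈ P i) :
    IsConn S (insert v (I.biUnion P)) := by
  classical
  induction I using Finset.induction_on with
  | empty => simpa using isConn_singleton (S := S) v
  | insert i I hi ih =>
    have h1 : IsConn S (insert v (I.biUnion P)) := ih fun j hj => hP j (Finset.mem_insert_of_mem hj)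
    rw [Finset.biUnion_insert, Finset.insert_eq, ← Finset.union_assoc, Finset.union_comm {v} (P i),
      Finset.union_assoc, ← Finset.insert_eq]
    by_cases hne : (P i).Nonempty
    · obtain ⟨hc, hv⟩ := hP i (Finset.mem_insert_self i I) hne
      have := h1.union hc (Or.inr ⟨v, Finset.mem_inter.2 ⟨Finset.mem_insert_self v _, hv⟩⟩)
      rwa [Finset.union_comm] at this
    · rw [Finset.not_nonempty_iff_eq_empty.1 hne, Finset.empty_union]
      exact h1

end Summit.PneNP.PneNP.Theorems.ColumnTwo
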